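import Summits.AtomisticToContinuum.Crystallization.Theorems.FluxTubeKeplerFloorGivesLayered
import Summits.AtomisticToContinuum.Crystallization.Theorems.FluxTubeKeplerFluxCellKeplerSingleScale
import Summits.AtomisticToContinuum.Crystallization.Theorems.ChessboardParticlePlanesPeriodicWindowsIffCrystallization

/-!
# F4 on-path lemma for the forward rung `GrainBlindRung` (grain ladder over `FluxTubeKepler.FloorGivesLayered`)

`Crystallization → GrainRung κ` for every fineness `κ` (in particular `→ GrainBlindRung = ∃ κ > 0, GrainRung κ`): the
landed hull-criterion converse `ChessboardParticlePlanesPeriodicWindowsIffCrystallization.periodicWindows_of_crystallization`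
gives periodic windows along every Lennard-Jones ground-state sequence outright, so every member of the family is a
CONSEQUENCE of the sub-problem (the rung lies on the path floor → summit).  Self-contained copy (sub-namespace `OnPath`)
of the definitions of `Lines/GrainBlindRung.lean`; the canonical `GrainLadder.grainRung_of_crystallization` /
`GrainLadder.GrainBlindRung_of_Crystallization` live there with the same text.  No `sorry`.
-/

noncomputable section

namespace Summit.AtomisticToContinuum.Crystallization.Cruxes.FluxCellKepler.GrainLadder.OnPath

open scoped BigOperators Classical
open Filter Topology
open Literature.MathematicalPhysics.StatisticalMechanics
open Summit.AtomisticToContinuum.Crystallization.Theorems.FluxCellKeplerSingleScale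
  (LayeredGood layeredGood_mono card_bad_le)
open Summit.AtomisticToContinuum.Crystallization.Theorems.ChargedEnergyGapNegative
  (eStar card_mul_eStar_le crysEnergyLimit)
open Summit.AtomisticToContinuum.Crystallization.Theorems.PrestressSplitKorn
  (SetLayeredNear layeredPos InBox)

local notation "E3" => EuclideanSpace ℝ (Fin 3)

/-- FLOOR(P₀): `N · e(P₀) ≤ E(x)` for every Lennard-Jones ground state (verbatim the floor's first hypothesis). -/
def Floor (P₀ : PeriodicConfiguration 3) : Prop :=
  ∀ (N : ℕ) (x : Fin N → E3), IsGroundState lennardJones x →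
    (N : ℝ) * P₀.energyPerParticle lennardJones ≤ interactionEnergy lennardJones x

/-- **Polycrystal template**: `k` convex CELLS — the maximality cells `{p | ∀ j', ⟪n j', p⟫ + t j' ≤ ⟪n j, p⟫ + t j}`
of `k` pairwise distinct affine functions `p ↦ ⟪n j, p⟫ + t j` (half-spaces, slabs, wedges of dihedral angle `≥ 60°` once fat,
power / Voronoi diagrams …; they cover space when `k ≥ 1`, and two distinct cells meet in a plane at most) — the cell `j`
filled by its OWN rigid admissible layered GRAIN `A j (layeredPos (a j) (s j) (z j) ·) + τ j` (spacing and interlayer gaps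
in the floor's box `InBox`, Hägg word `s j`, linear isometry `A j`, arbitrary translation `τ j`).  One cell (`k = 1`,
`n = 0`, `t = 0`) is a single admissible layered set. -/
structure PolyTemplate where
  /-- number of cells / grains -/
  k : ℕ
  /-- gradients of the affine functions defining the cells -/
  n : Fin k → E3
  /-- offsets of the affine functions defining the cells -/
  t : Fin k → ℝ
  /-- translation of grain `j` -/
  τ : Fin k → E3
  /-- in-plane spacing of grain `j` -/
  a : Fin k → ℝ
  /-- frame of grain `j` -/
  A : Fin k → (E3 →ₗᵢ[ℝ] E3)
  /-- Hägg word of grain `j` -/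
  s : Fin k → ℤ → ℤ
  /-- layer heights of grain `j` -/
  z : Fin k → ℤ → ℝ
  /-- every grain is an admissible layered set (the floor's box) -/
  box : ∀ j, InBox (a j) (z j) ∧ IsHaggSeq (s j)
  /-- the affine functions are pairwise distinct (so distinct cells overlap in a plane at most: no multiply-filled
  cell; with fatness this bounds the local density of the polycrystal) -/
  nodup : Function.Injective fun j => (n j, t j)

namespace PolyTemplate

/-- Cell `j`: where the `j`-th affine function is maximal (a closed convex polyhedron). -/
def cell (T : PolyTemplate) (j : Fin T.k) : Set E3 :=
  {p | ∀ j' : Fin T.k, inner ℝ (T.n j') p + T.t j' ≤ inner ℝ (T.n j) p + T.t j}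

/-- Grain `j`: the rigid admissible layered set `A j (layeredPos …) + τ j`. -/
def grain (T : PolyTemplate) (j : Fin T.k) : Set E3 :=
  {p | ∃ l : ℤ × ℤ × ℤ, p = T.A j (layeredPos (T.a j) (T.s j) (T.z j) l) + T.τ j}

/-- The polycrystal: cell `j` carries grain `j`. -/
def carrier (T : PolyTemplate) : Set E3 :=
  {p | ∃ j : Fin T.k, p ∈ T.cell j ∧ p ∈ T.grain j}

/-- `1/κ`-FATNESS of the cells (`κ ≥ 0` the grain fineness): every point of every cell lies within `2r` of the centre
of a ball of radius `r`, `κ·r ≥ 1`, contained in the cell.  `κ = 0`: no cell qualifies (`1 ≤ 0·r` is false). -/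
def Fat (T : PolyTemplate) (κ : ℝ) : Prop :=
  ∀ (j : Fin T.k) (p : E3), p ∈ T.cell j →
    ∃ (q : E3) (r : ℝ), 1 ≤ κ * r ∧ dist p q ≤ 2 * r ∧ Metric.closedBall q r ⊆ T.cell j

end PolyTemplate

/-- The `R`-ball of relative positions around `x i` is two-way `η`-matched with the `1/κ`-fat polycrystal template `T`. -/
def PolyGoodVia (κ R η : ℝ) {N : ℕ} (x : Fin N → E3) (i : Fin N) (T : PolyTemplate) : Prop :=
  T.Fat κ ∧
    (∀ p ∈ T.carrier, ‖p‖ ≤ R → ∃ j : Fin N, dist (x j - x i) p ≤ η) ∧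
    (∀ j : Fin N, ‖x j - x i‖ ≤ R → ∃ p ∈ T.carrier, dist (x j - x i) p ≤ η)

/-- `κ`-POLYCRYSTAL-GOOD site: some `1/κ`-fat polycrystal template matches the `R`-ball around `x i` two-way with
tolerance `η`. -/
def PolyGood (κ R η : ℝ) {N : ℕ} (x : Fin N → E3) (i : Fin N) : Prop :=
  ∃ T : PolyTemplate, PolyGoodVia κ R η x i T

/-- `κ`-GRAIN-GOOD site: layered-good (the floor's predicate, verbatim by name) OR `κ`-polycrystal-good.
`κ = 0`: the floor's predicate (`grainGood_zero_iff`); `κ = 1/2`: clean polycrystals of `2`-fat grains are good. -/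
def GrainGood (κ R η : ℝ) {N : ℕ} (x : Fin N → E3) (i : Fin N) : Prop :=
  LayeredGood R η x i ∨ PolyGood κ R η x i

/-- GRAIN-BLIND BUDGET with dial `κ`: at every scale `(R,η)` some `c > 0` prices the sites that are not `κ`-grain-good
against the excess energy over `N · e(P₀)` (`κ = 0`: the floor's budget; the crux's quantifier order `∀ R η, ∃ c`). -/
def GrainBudget (κ : ℝ) (P₀ : PeriodicConfiguration 3) : Prop :=
  ∀ R η : ℝ, 0 < R → 0 < η → ∃ c : ℝ, 0 < c ∧
    ∀ (N : ℕ) (x : Fin N → E3), IsGroundState lennardJones x →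
      c * (Nat.card {i : Fin N // ¬ GrainGood κ R η x i} : ℝ) ≤
        interactionEnergy lennardJones x - (N : ℝ) * P₀.energyPerParticle lennardJones

/-- Periodic windows at every scale along `x` (verbatim the conclusion of `FluxTubeKepler.PeriodicGivenLayered`). -/
def HasPeriodicWindows (x : (N : ℕ) → (Fin N → E3)) : Prop :=
  ∃ P : PeriodicConfiguration 3, ∀ R ε : ℝ, 0 < ε → ∃ᶠ N in atTop, ∃ t : E3,
    (∀ s ∈ P.points, ‖s‖ ≤ R → ∃ i : Fin N, dist (x N i + t) s ≤ ε) ∧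
    (∀ i : Fin N, ‖x N i + t‖ ≤ R → ∃ s ∈ P.points, dist (x N i + t) s ≤ ε)

/-- **The graded family.** `GrainRung κ`: FLOOR and the budget that leaves clean `1/κ`-fat polycrystalline sites
unpriced force periodic windows along every Lennard-Jones ground-state sequence. -/
def GrainRung (κ : ℝ) : Prop :=
  ∀ P₀ : PeriodicConfiguration 3, Floor P₀ → GrainBudget κ P₀ →
    ∀ x : (N : ℕ) → (Fin N → E3), (∀ N, IsGroundState lennardJones (x N)) → HasPeriodicWindows x

/-- **Deciding rung.** For SOME positive fineness `κ` the budget need not price ORIENTATION TEXTURE above the grain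
size `2/κ`: pricing only the sites whose `R`-neighbourhood is not `η`-close to some polycrystal of `1/κ`-fat admissible
layered grains (any number of grains, any frames, any fat convex cells) suffices — the single frame of the windows is then
selected by the energy (grain-boundary tension ⇒ coarsening).  (`∃ κ > 0`, not a hand-picked fineness: the first member
of the dial above the floor `κ = 0`; every member is a real step — the ideal polycrystal with cubic `1/κ`-fat grains in
generic orientations is `κ`-grain-good at every site and scale and layered-good at none.) -/
def GrainBlindRung : Prop := ∃ κ : ℝ, 0 < κ ∧ GrainRung κ

/-! ## Predicate bookkeeping -/

/-- No cell is `1/0`-fat: at fineness `κ = 0` no site is polycrystal-good (for `R ≥ 0`). -/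
theorem not_polyGood_zero {R η : ℝ} (hR : 0 ≤ R) {N : ℕ} (x : Fin N → E3) (i : Fin N) :
    ¬ PolyGood 0 R η x i := by
  rintro ⟨T, hfat, -, h₂⟩
  obtain ⟨p, hp, -⟩ := h₂ i (by simp [hR])
  obtain ⟨j, hj, -⟩ := hp
  obtain ⟨q, r, h1, -, -⟩ := hfat j p hj
  norm_num at h1

/-- The floor's predicate is the member `κ = 0` of the family. -/
theorem grainGood_zero_iff {R η : ℝ} (hR : 0 ≤ R) {N : ℕ} (x : Fin N → E3) (i : Fin N) :
    GrainGood 0 R η x i ↔ LayeredGood R η x i :=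
  ⟨fun h => h.elim id fun hP => (not_polyGood_zero hR x i hP).elim, Or.inl⟩

theorem fat_mono {κ κ' : ℝ} (hκ : κ ≤ κ') (T : PolyTemplate) : T.Fat κ → T.Fat κ' := by
  intro h j p hp
  obtain ⟨q, r, h1, h2, h3⟩ := h j p hp
  have hr : 0 ≤ r := by linarith [dist_nonneg (x := p) (y := q)]
  exact ⟨q, r, h1.trans (mul_le_mul_of_nonneg_right hκ hr), h2, h3⟩

theorem polyGood_mono {κ κ' : ℝ} (hκ : κ ≤ κ') {R η : ℝ} {N : ℕ} (x : Fin N → E3) (i : Fin N) :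
    PolyGood κ R η x i → PolyGood κ' R η x i := by
  rintro ⟨T, hfat, h₁, h₂⟩
  exact ⟨T, fat_mono hκ T hfat, h₁, h₂⟩

theorem grainGood_mono {κ κ' : ℝ} (hκ : κ ≤ κ') {R η : ℝ} {N : ℕ} (x : Fin N → E3) (i : Fin N) :
    GrainGood κ R η x i → GrainGood κ' R η x i :=
  fun h => h.elim Or.inl fun hP => Or.inr (polyGood_mono hκ x i hP)

/-- `GrainGood κ` is antitone in the radius and monotone in the tolerance. [folklore] -/
theorem polyGood_mono_scale {κ R R' η η' : ℝ} (hR : R ≤ R') (hη : η' ≤ η) {N : ℕ}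
    (x : Fin N → E3) (i : Fin N) : PolyGood κ R' η' x i → PolyGood κ R η x i := by
  rintro ⟨T, hfat, h₁, h₂⟩
  refine ⟨T, hfat, ?_, ?_⟩
  · intro p hp hpR
    obtain ⟨j, hj⟩ := h₁ p hp (hpR.trans hR)
    exact ⟨j, hj.trans hη⟩
  · intro j hj
    obtain ⟨p, hp, hjp⟩ := h₂ j (hj.trans hR)
    exact ⟨p, hp, hjp.trans hη⟩

/-- The ONE-CELL template (`k = 1`, `n = 0`, `t = 0`, `τ = 0`) of an admissible layered set. -/
def oneCell (a : ℝ) (A : E3 →ₗᵢ[ℝ] E3) (s : ℤ → ℤ) (z : ℤ → ℝ) (h : InBox a z ∧ IsHaggSeq s) :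
    PolyTemplate where
  k := 1
  n := fun _ => 0
  t := fun _ => 0
  τ := fun _ => 0
  a := fun _ => a
  A := fun _ => A
  s := fun _ => s
  z := fun _ => z
  box := fun _ => h
  nodup := fun _ _ _ => Subsingleton.elim _ _

theorem oneCell_cell (a : ℝ) (A : E3 →ₗᵢ[ℝ] E3) (s : ℤ → ℤ) (z : ℤ → ℝ) (h : InBox a z ∧ IsHaggSeq s)
    (j : Fin 1) : (oneCell a A s z h).cell j = Set.univ := by
  ext p
  simp [PolyTemplate.cell, oneCell]

theorem oneCell_carrier (a : ℝ) (A : E3 →ₗᵢ[ℝ] E3) (s : ℤ → ℤ) (z : ℤ → ℝ) (h : InBox a z ∧ IsHaggSeq s) :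
    (oneCell a A s z h).carrier = {p | ∃ l : ℤ × ℤ × ℤ, p = A (layeredPos a s z l)} := by
  ext p
  have hc : ∀ j, p ∈ (oneCell a A s z h).cell j := fun j => by rw [oneCell_cell]; trivial
  simp only [PolyTemplate.carrier, PolyTemplate.grain, Set.mem_setOf_eq]
  constructor
  · rintro ⟨j, -, l, hl⟩
    exact ⟨l, by simpa [oneCell] using hl⟩
  · rintro ⟨l, rfl⟩
    exact ⟨⟨0, Nat.one_pos⟩, hc _, l, by simp [oneCell]⟩

/-- For a POSITIVE fineness the disjunction collapses: a layered-good site is `κ`-polycrystal-good for the one-cell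
template (the whole space is one `1/κ`-fat cell).  So `GrainGood κ = PolyGood κ` for `κ > 0`, while `GrainGood 0 =
LayeredGood`. [folklore] -/
theorem polyGood_of_layeredGood {κ : ℝ} (hκ : 0 < κ) {R η : ℝ} {N : ℕ} (x : Fin N → E3) (i : Fin N) :
    LayeredGood R η x i → PolyGood κ R η x i := by
  rintro ⟨a, ha₁, ha₂, A, s, z, hs, hz, h₁, h₂⟩
  refine ⟨oneCell a A s z ⟨⟨ha₁, ha₂, hz⟩, hs⟩, ?_, ?_, ?_⟩
  · intro j p _
    refine ⟨p, 1 / κ, ?_, ?_, ?_⟩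
    · rw [mul_one_div_cancel hκ.ne']
    · rw [dist_self]; positivity
    · rw [oneCell_cell]; exact Set.subset_univ _
  · intro p hp hpR
    rw [oneCell_carrier] at hp
    obtain ⟨l, rfl⟩ := hp
    exact h₁ _ ⟨l.1, l.2.1, l.2.2, rfl⟩ hpR
  · intro j hj
    obtain ⟨p, ⟨m, k, l, rfl⟩, hjp⟩ := h₂ j hj
    refine ⟨_, ?_, hjp⟩
    rw [oneCell_carrier]
    exact ⟨(m, k, l), rfl⟩

theorem grainGood_iff_polyGood {κ : ℝ} (hκ : 0 < κ) {R η : ℝ} {N : ℕ} (x : Fin N → E3) (i : Fin N) :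
    GrainGood κ R η x i ↔ PolyGood κ R η x i :=
  ⟨fun h => h.elim (polyGood_of_layeredGood hκ x i) id, Or.inr⟩

/-- The budget is monotone in the dial: a budget pricing the larger bad set prices the smaller one. -/
theorem grainBudget_mono {κ κ' : ℝ} (hκ : κ ≤ κ') (P₀ : PeriodicConfiguration 3) :
    GrainBudget κ P₀ → GrainBudget κ' P₀ := by
  intro hB R η hR hη
  obtain ⟨c, hc, hcB⟩ := hB R η hR hη
  refine ⟨c, hc, fun N x hx => le_trans ?_ (hcB N x hx)⟩
  have hle : Nat.card {i : Fin N // ¬ GrainGood κ' R η x i} ≤ Nat.card {i : Fin N // ¬ GrainGood κ R η x i} := by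
    rw [Nat.card_eq_fintype_card, Nat.card_eq_fintype_card]
    exact Fintype.card_subtype_mono _ _ fun i hi hg => hi (grainGood_mono hκ x i hg)
  exact mul_le_mul_of_nonneg_left (by exact_mod_cast hle) hc.le

/-! ## F3 — the family specialises to the proved floor -/

/-- `GrainRung 0` is the floor: the seed theorem followed by the proved `PeriodicGivenLayered` (the only rewriting is
`grainGood_zero_iff`: at fineness `0` the polycrystal disjunct is void). -/
theorem grainRung_zero : GrainRung 0 := by
  intro P₀ hF hB x hx
  refine Theses.FluxTubeKepler.PeriodicGivenLayered_holds x hx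
    (Theorems.FluxTubeKeplerFloorGivesLayered.FloorGivesLayered_proof P₀ hF ?_ x hx)
  intro R η hR hη
  obtain ⟨c, hc, hcB⟩ := hB R η hR hη
  refine ⟨c, hc, fun N y hy => ?_⟩
  show c * (Nat.card {i : Fin N // ¬ LayeredGood R η y i} : ℝ) ≤ _
  refine le_trans ?_ (hcB N y hy)
  have hle : Nat.card {i : Fin N // ¬ LayeredGood R η y i} ≤
      Nat.card {i : Fin N // ¬ GrainGood 0 R η y i} := by
    rw [Nat.card_eq_fintype_card, Nat.card_eq_fintype_card]
    exact Fintype.card_subtype_mono _ _ fun i hi hg => hi ((grainGood_zero_iff hR.le y i).1 hg)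
  exact mul_le_mul_of_nonneg_left (by exact_mod_cast hle) hc.le

/-! ## Dial monotonicity (harder-to-easier = decreasing the fineness `κ`) -/

theorem grainRung_anti {κ κ' : ℝ} (hκ : κ ≤ κ') : GrainRung κ' → GrainRung κ :=
  fun H P₀ hF hB x hx => H P₀ hF (grainBudget_mono hκ P₀ hB) x hx

/-- The deciding rung gives the floor member `κ = 0` (informational `specialises`). -/
theorem grainRung_zero_of_grainBlindRung (h : GrainBlindRung) : GrainRung 0 := by
  obtain ⟨κ, hκ, h⟩ := h
  exact grainRung_anti hκ.le h

/-! ## F4 — on-path lemmas: the sub-problem implies every member -/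

theorem grainRung_of_crystallization (κ : ℝ) (h : _root_.Crystallization) : GrainRung κ :=
  fun _ _ _ x hx =>
    Theorems.ChessboardParticlePlanesPeriodicWindowsIffCrystallization.periodicWindows_of_crystallization h x hx

@[aesop safe apply]
theorem GrainBlindRung_of_Crystallization (h : _root_.Crystallization) : GrainBlindRung :=
  ⟨1, one_pos, grainRung_of_crystallization 1 h⟩

end Summit.AtomisticToContinuum.Crystallization.Cruxes.FluxCellKepler.GrainLadder.OnPath

end
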